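import Summits.BirchSwinnertonDyer.BirchSwinnertonDyer.Theorems.KolyvaginRankRigidityAtTwoClassesIntoSelmerGood
import Summits.BirchSwinnertonDyer.BirchSwinnertonDyer.Theorems.KolyvaginRankRigidityAtTwoOffHabitatIrredNonSurjTwoConverseNoTwoTorsionOverKOfIrred
import HarnessLib

/-!
# Route `KolyvaginRankRigidityAtTwo`, residual crux R_irr `OffHabitatIrredNonSurjTwoConverse`
# (stmt-BirchSwinnertonDyer-27123, LINE 8 «margin absorbs index»): `H¹(K, E[2^M]) ↪ H¹(K, E[2^∞])`
# OFF THE HABITAT — Kummer/level-raising injectivity from `E(ℚ)[2] = 0` alone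
# (helper, PROVED, unconditional; width seat `bsd-line-krr2-p2` g9)

The habitat file `…ClassesIntoSelmerGood` §2 (i-a) derives the injectivity of the level-raising map
`torsionPowToPrimaryH1 (E/K) 2 M : H¹(K, E[2^M]) → H¹(K, E[2^∞])` (order of Kolyvagin classes
preserved in the `Sel_{2^∞}`/corank currency of V2♭) from `ρ̄_{E,2}` ONTO, through `E(K)[2] = 0`.
Off the habitat (frame of R_irr: `E(ℚ)[2] = 0`, any `2`-adic image) `E(K)[2] = 0` is the landed stub
`stub_noTwoTorsionOverK_of_irred` (p634161), and the tree's generic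
`torsionPowToPrimaryH1_injective_of_torsionBy_eq_bot` concludes. Results:
`torsionPowToPrimaryH1_two_injective_offHabitat`, `addOrderOf_torsionPowToPrimaryH1_two_eq_offHabitat`,
`torsionPowToPrimaryH1_two_ne_zero_offHabitat`. With the four other finite-index suppliers landed
this generation (inflation defect from Serre's open image, simplicity of `E[2]`, `E(K[n])[2] = 0`/`hA`,
finite-index one-class Čebotarev), every use of the mod-`2` / `2`-adic image in the KRR `∞`-kernel
has an off-habitat replacement from `E(ℚ)[2] = 0` (+ the named fact
`serre_adicImage_contains_congruenceSubgroup` for the Sah bit).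

HONEST FRAMING: helper lemmas (`--supports` 27123); nothing here closes R_irr, U1 28083 or the print
item 23091; BSD is NOT proved by any of this.

References: [WZhang2014] p. 248; [GrossLMS1991] §4 (proof of Prop. 4.1), §2 ((2.2));
[SilvermanAEC2009] Ex. III.3.7 (d).
-/

set_option autoImplicit false
-- the Theorems namespace of this sub repeats the summit name by design (D-0017 nested layout)
set_option linter.dupNamespace false

noncomputable section

open scoped Classical

namespace Summit.BirchSwinnertonDyer.BirchSwinnertonDyer.Theorems.KolyvaginRankRigidity

open WeierstrassCurve Literature.NumberTheory.EllipticCurves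

variable {K : Type} [Field K] [NumberField K] (W : WeierstrassCurve ℚ) [W.IsElliptic]

/-- **`H¹(K, E[2^M]) ↪ H¹(K, E[2^∞])` off the habitat**: for `W/ℚ` elliptic with `E(ℚ)[2] = 0` and
`K` imaginary quadratic, the level-raising map `torsionPowToPrimaryH1 (E/K) 2 M` is injective
(`E(K)[2] = 0` by the stub `stub_noTwoTorsionOverK_of_irred`). [cite: WZhang2014, p. 248]
[cite: GrossLMS1991, §4 (proof of Prop. 4.1)] -/
theorem torsionPowToPrimaryH1_two_injective_offHabitat
    (htorQ : AddSubgroup.torsionBy W.toAffine.Point (2 : ℤ) = ⊥) (hK : IsImaginaryQuadratic K)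
    (M : ℕ) : Function.Injective (torsionPowToPrimaryH1 (W.baseChange K) 2 M) := by
  have htor : AddSubgroup.torsionBy (W.baseChange K).toAffine.Point (2 : ℤ) = ⊥ :=
    stub_noTwoTorsionOverK_of_irred W htorQ K hK
  exact torsionPowToPrimaryH1_injective_of_torsionBy_eq_bot (W.baseChange K) 2 M
    (by exact_mod_cast htor)

/-- **Order preserved off the habitat**: the image of a level-`2^M` class in `H¹(K, E[2^∞])` has
the same additive order. [cite: WZhang2014, p. 248] -/
theorem addOrderOf_torsionPowToPrimaryH1_two_eq_offHabitat
    (htorQ : AddSubgroup.torsionBy W.toAffine.Point (2 : ℤ) = ⊥) (hK : IsImaginaryQuadratic K)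
    (M : ℕ) (c : galH1Torsion (W.baseChange K) ((2 ^ M : ℕ) : ℤ)) :
    addOrderOf (torsionPowToPrimaryH1 (W.baseChange K) 2 M c) = addOrderOf c :=
  addOrderOf_injective _ (torsionPowToPrimaryH1_two_injective_offHabitat W htorQ hK M) c

/-- A non-zero level-`2^M` class is non-zero in `H¹(K, E[2^∞])`, off the habitat.
[cite: WZhang2014, p. 248] -/
theorem torsionPowToPrimaryH1_two_ne_zero_offHabitat
    (htorQ : AddSubgroup.torsionBy W.toAffine.Point (2 : ℤ) = ⊥) (hK : IsImaginaryQuadratic K)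
    (M : ℕ) {c : galH1Torsion (W.baseChange K) ((2 ^ M : ℕ) : ℤ)} (hc : c ≠ 0) :
    torsionPowToPrimaryH1 (W.baseChange K) 2 M c ≠ 0 := fun h ↦
  hc ((torsionPowToPrimaryH1_two_injective_offHabitat W htorQ hK M) (h.trans (map_zero _).symm))

end Summit.BirchSwinnertonDyer.BirchSwinnertonDyer.Theorems.KolyvaginRankRigidity

end
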